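import Summits.AtomisticToContinuum.Crystallization.Theorems.LayeredLawsSelectHcp.Negative.DiracLaws

/-!
# Negative knowledge for crux `LayeredLawsSelectHcp` (stmt-AtomisticToContinuum-9226), II:
# integer bookkeeping — the `A₃` form of the ideal fcc stacking and the cubic coordinates `ψ`

Part II (`--supports stmt-AtomisticToContinuum-9226`). For the constant Hägg sequence (fcc) the integer
distance form of `BarlowCoordination.twelve_mul_dist_barlowPos_sq` is `12·qf`, `qf(i,j,k) = i²+j²+k²+ij+jk+ki`
the `A₃`/`D₃` form (`form_const`), so in the ideal unit fcc stacking `dist² = qf(Δi,Δj,Δk)`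
(`dist_sq_hexFcc`) and indices are unique (`barlowPos_const_injective`); `qf ≥ 1` off the origin
(`one_le_qf`). The index map `ψ(k,i,j) = (−(i+j), k+i, k+j)` to cubic `D₃` coordinates is injective,
additive, has even coordinate sum `2k` and `|ψ|² = 2·qf` (`sqNormInt_psi`). Even-sum integer vectors have
even squared norm, `≥ 2` when non-zero (`two_le_sqNormInt`), and those of squared norm `2` are exactly the
twelve minimal vectors `fccInt` of `KissingPatterns` (`mem_fccInt_of_sqNormInt`, the converse of
`sqNormInt_fccInt`). All `[folklore]`.
-/

noncomputable section

namespace Summit.AtomisticToContinuum.Crystallization.Theorems.LayeredLawsSelectHcp.Negative.IntegerForms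

open MeasureTheory Set
open Literature.MathematicalPhysics.StatisticalMechanics Literature.Geometry.DiscreteGeometry
open Summit.AtomisticToContinuum.Crystallization.Theses.PalmUnimodularRigidity (LayeredLawsSelectHcp)
open Summit.AtomisticToContinuum.Crystallization.Theorems.ChargedEnergyGapNegative
  (eStar eStar_le bddBelow_energyPerParticle_lennardJones)

/-- Euclidean `3`-space. [folklore] -/
local notation "E3" => EuclideanSpace ℝ (Fin 3)
open Summit.AtomisticToContinuum.Crystallization.Theorems.LayeredLawsSelectHcp.Negative.DiracLaws

/-! ## §3 Integer bookkeeping: the `D₃` form and the cubic coordinates of fcc -/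

/-- The fcc (`D₃` / `A₃`) quadratic form in hexagonal-layer indices: for the ideal fcc stacking
`dist² = a² · qf (Δi) (Δj) (Δk)` (`dist_sq_hexFcc`). [folklore] -/
def qf (i j k : ℤ) : ℤ := i ^ 2 + j ^ 2 + k ^ 2 + i * j + j * k + k * i

/-- `2·qf` is a sum of three squares. [folklore] -/
theorem two_mul_qf (i j k : ℤ) : 2 * qf i j k = (i + j) ^ 2 + (j + k) ^ 2 + (k + i) ^ 2 := by
  unfold qf; ring

/-- `qf ≥ 0`. [folklore] -/
theorem qf_nonneg (i j k : ℤ) : 0 ≤ qf i j k := by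
  nlinarith [two_mul_qf i j k, sq_nonneg (i + j), sq_nonneg (j + k), sq_nonneg (k + i)]

/-- `qf ≥ 1` off the origin (positive definiteness). [folklore] -/
theorem one_le_qf {i j k : ℤ} (h : (i, j, k) ≠ (0, 0, 0)) : 1 ≤ qf i j k := by
  by_contra hlt
  push Not at hlt
  have h2 := two_mul_qf i j k
  have h3 : (i + j) ^ 2 + (j + k) ^ 2 + (k + i) ^ 2 ≤ 0 := by linarith
  have ha : (i + j) ^ 2 = 0 := by nlinarith [sq_nonneg (i + j), sq_nonneg (j + k), sq_nonneg (k + i)]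
  have hb : (j + k) ^ 2 = 0 := by nlinarith [sq_nonneg (i + j), sq_nonneg (j + k), sq_nonneg (k + i)]
  have hc : (k + i) ^ 2 = 0 := by nlinarith [sq_nonneg (i + j), sq_nonneg (j + k), sq_nonneg (k + i)]
  have ha' : i + j = 0 := pow_eq_zero_iff (two_ne_zero) |>.1 ha
  have hb' : j + k = 0 := pow_eq_zero_iff (two_ne_zero) |>.1 hb
  have hc' : k + i = 0 := pow_eq_zero_iff (two_ne_zero) |>.1 hc
  apply h
  simp only [Prod.mk.injEq]
  omega

/-- For the constant Hägg sequence (fcc) the integer distance form of `BarlowCoordination` is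
`12 · qf`. [folklore] -/
theorem form_const (k i j k' i' j' : ℤ) :
    3 * (2 * (i - i') + (j - j') + (haggLabel constHagg k - haggLabel constHagg k')) ^ 2 +
        (3 * (j - j') + (haggLabel constHagg k - haggLabel constHagg k')) ^ 2 + 8 * (k - k') ^ 2 =
      12 * qf (i - i') (j - j') (k - k') := by
  simp only [haggLabel_const]
  unfold qf
  ring

/-- **Distances in the ideal unit fcc stacking**: `dist² = qf(Δi, Δj, Δk)`. [folklore] -/
theorem dist_sq_hexFcc {η : ℝ} (hη : η ^ 2 = 2 / 3) (k i j k' i' j' : ℤ) :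
    dist (barlowPos 1 η constHagg k i j) (barlowPos 1 η constHagg k' i' j') ^ 2 =
      (qf (i - i') (j - j') (k - k') : ℝ) := by
  have h := twelve_mul_dist_barlowPos_sq (a := 1) (h := η) (by rw [one_pow, mul_one]; exact hη)
    constHagg k i j k' i' j'
  rw [form_const] at h
  push_cast at h
  linarith

/-- The index map of the ideal unit fcc stacking is injective. [folklore] -/
theorem barlowPos_const_injective {η : ℝ} (hη : η ^ 2 = 2 / 3) {k i j k' i' j' : ℤ}
    (h : barlowPos 1 η constHagg k i j = barlowPos 1 η constHagg k' i' j') :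
    k = k' ∧ i = i' ∧ j = j' := by
  by_contra hne
  have hne' : (k, i, j) ≠ (k', i', j') := by simpa [Prod.ext_iff] using hne
  have h1 := le_dist_barlowPos_of_ideal (a := 1) (h := η) (s := constHagg) isHaggSeq_const one_pos
    (by rw [one_pow, mul_one]; exact hη) hne'
  rw [h, dist_self] at h1
  linarith

/-- `ψ(k, i, j) = (−(i+j), k+i, k+j)`: hexagonal-layer indices of the ideal fcc stacking to cubic
(`D₃`) integer coordinates. [folklore] -/
def psi (t : ℤ × ℤ × ℤ) : Fin 3 → ℤ := ![-(t.2.1 + t.2.2), t.1 + t.2.1, t.1 + t.2.2]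

/-- `|ψ(k,i,j)|² = 2 qf(i,j,k)`. [folklore] -/
theorem sqNormInt_psi (t : ℤ × ℤ × ℤ) : sqNormInt (psi t) = 2 * qf t.2.1 t.2.2 t.1 := by
  simp [sqNormInt, psi, qf]
  ring

/-- `ψ` is additive. [folklore] -/
theorem psi_sub (t t' : ℤ × ℤ × ℤ) :
    psi t - psi t' = psi (t.1 - t'.1, t.2.1 - t'.2.1, t.2.2 - t'.2.2) := by
  ext l
  fin_cases l <;> simp [psi] <;> ring

/-- The coordinate sum of `ψ(k,i,j)` is `2k` (even). [folklore] -/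
theorem psi_sum (t : ℤ × ℤ × ℤ) : psi t 0 + psi t 1 + psi t 2 = 2 * t.1 := by
  simp [psi]
  ring

/-- `ψ` is injective. [folklore] -/
theorem psi_injective : Function.Injective psi := by
  intro t t' h
  have h0 := congrFun h 0
  have h1 := congrFun h 1
  have h2 := congrFun h 2
  simp [psi] at h0 h1 h2
  refine Prod.ext ?_ (Prod.ext ?_ ?_) <;> omega

/-- Squared norms of even-sum integer vectors are even. [folklore] -/
theorem even_sqNormInt {u : Fin 3 → ℤ} (he : Even (u 0 + u 1 + u 2)) : Even (sqNormInt u) := by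
  have : sqNormInt u = (u 0 * (u 0 + 1) + u 1 * (u 1 + 1) + u 2 * (u 2 + 1)) - (u 0 + u 1 + u 2) := by
    unfold sqNormInt; ring
  rw [this]
  exact (((Int.even_mul_succ_self _).add (Int.even_mul_succ_self _)).add
    (Int.even_mul_succ_self _)).sub he

/-- A non-zero even-sum integer vector has squared norm `≥ 2`. [folklore] -/
theorem two_le_sqNormInt {u : Fin 3 → ℤ} (hu : u ≠ 0) (he : Even (u 0 + u 1 + u 2)) :
    2 ≤ sqNormInt u := by
  have hpos : 1 ≤ sqNormInt u := by
    by_contra hlt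
    push Not at hlt
    have h3 : u 0 ^ 2 + u 1 ^ 2 + u 2 ^ 2 ≤ 0 := by unfold sqNormInt at hlt; linarith
    have e0 : u 0 ^ 2 = 0 := le_antisymm (by nlinarith [sq_nonneg (u 1), sq_nonneg (u 2)]) (sq_nonneg _)
    have e1 : u 1 ^ 2 = 0 := le_antisymm (by nlinarith [sq_nonneg (u 0), sq_nonneg (u 2)]) (sq_nonneg _)
    have e2 : u 2 ^ 2 = 0 := le_antisymm (by nlinarith [sq_nonneg (u 0), sq_nonneg (u 1)]) (sq_nonneg _)
    apply hu
    funext l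
    fin_cases l
    · exact pow_eq_zero_iff two_ne_zero |>.1 e0
    · exact pow_eq_zero_iff two_ne_zero |>.1 e1
    · exact pow_eq_zero_iff two_ne_zero |>.1 e2
  rcases even_sqNormInt he with ⟨m, hm⟩
  omega

/-- The converse of `sqNormInt_fccInt`: the integer vectors of squared norm `2` are the twelve
minimal vectors of `D₃`. [folklore] -/
theorem mem_fccInt_of_sqNormInt {v : Fin 3 → ℤ} (h : sqNormInt v = 2) : v ∈ fccInt := by
  have hv : v = ![v 0, v 1, v 2] := by
    funext l; fin_cases l <;> rfl
  set x := v 0 with hx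
  set y := v 1 with hy
  set z := v 2 with hz
  rw [hv] at h ⊢
  simp only [sqNormInt, Matrix.cons_val_zero, Matrix.cons_val_one, Matrix.cons_val_two,
    Matrix.tail_cons, Matrix.head_cons] at h
  have hx2 : x ^ 2 ≤ 2 := by nlinarith [sq_nonneg y, sq_nonneg z]
  have hy2 : y ^ 2 ≤ 2 := by nlinarith [sq_nonneg x, sq_nonneg z]
  have hz2 : z ^ 2 ≤ 2 := by nlinarith [sq_nonneg x, sq_nonneg y]
  have hx1 : -1 ≤ x ∧ x ≤ 1 := by constructor <;> nlinarith
  have hy1 : -1 ≤ y ∧ y ≤ 1 := by constructor <;> nlinarith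
  have hz1 : -1 ≤ z ∧ z ≤ 1 := by constructor <;> nlinarith
  obtain ⟨hx1, hx1'⟩ := hx1
  obtain ⟨hy1, hy1'⟩ := hy1
  obtain ⟨hz1, hz1'⟩ := hz1
  clear_value x y z
  interval_cases x <;> interval_cases y <;> interval_cases z <;> first | decide | (norm_num at h)

/-- Every minimal vector of `D₃` has even coordinate sum. [folklore] -/
theorem even_of_mem_fccInt : ∀ v ∈ fccInt, Even (v 0 + v 1 + v 2) := by decide

/-- `‖c • intVec v‖ = |c| √(|v|²)`. [folklore] -/
theorem norm_smul_intVec (c : ℝ) (v : Fin 3 → ℤ) :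
    ‖c • intVec v‖ = |c| * Real.sqrt (sqNormInt v : ℝ) := by
  rw [norm_smul, Real.norm_eq_abs, norm_intVec]

/-- `intVec` is additive. [folklore] -/
theorem intVec_add (v w : Fin 3 → ℤ) : intVec (v + w) = intVec v + intVec w := by
  ext l; simp [intVec]

/-- `intVec 0 = 0`. [folklore] -/
theorem intVec_zero : intVec 0 = 0 := by
  ext l; simp [intVec]

/-- `intVec (-v) = - intVec v`. [folklore] -/
theorem intVec_neg (v : Fin 3 → ℤ) : intVec (-v) = -intVec v := by
  ext l; simp [intVec]

end Summit.AtomisticToContinuum.Crystallization.Theorems.LayeredLawsSelectHcp.Negative.IntegerForms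

end
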